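/-
Width seat `ym-line-sgb-p1-w3` (gen 2, seat prover-ym-line-sgb-p1-w3-g2-0), route `SteinGapBootstrap`, crux U `FreeProbeLawG`
(stmt-QuantumFields-23756), line `birth` (lead ym-line-sgb-k1-g1, RESHAPE 2), registered stub `stub_blockGreen` — helper file (lattice potential theory).
-/
import Summits.QuantumFields.YangMills.Theorems.EquipartitionCriticalityEquipartitionPinsProbeKernelFixesExact
import Literature.Probability.LatticeModels.LatticeGreenGradient
import HarnessLib

/-!
# Line `birth` of crux U `FreeProbeLawG`: stub `stub_blockGreen`, helper lemmas (pure lattice potential theory on `ℤ⁴`)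

NOT THE CLAY GAP: route `SteinGapBootstrap` bears on the RECORD-label rung leaf R2ξ′ `WeakCouplingRates.XiPow` (an UPPER bound on the
lattice mass gap of torus-limit states); U itself stays open (child C1ᶠ `PairSteinDiscrepancyFreeG`, stmt-QuantumFields-23798).

The box-truncated Green `1`-form of a plaquette `p = (x; i<j)`: `ω = 1_{box R} · ω_∞` with `ω_∞(e) = Σ_a σ_a Γ(∂_a p, e)`,
`Γ = edgeGreen = [dir = dir']·G₀(· − ·)`, `G₀ = latticeGreen/2 = (−Δ)⁻¹`.  The four clauses of the stub:
(1) support in the box — by definition; (2) `ℓ¹`-mass `≤ Cg (1+R)^4` — `|latticeGreen| ≤ M` (`latticeGreen_asymptotics`) and the box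
has `4(2R+1)^4` edges; (3) `dω = curvatureTwoPoint p ·` on plaquettes well inside — `dω_∞ = Π(p,·)` EXACTLY by the definition of
`curvatureTwoPoint`; (4) `|‖dω‖² − Π(p,p)| ≤ Cg(1+R)^{-2}`: NO Parseval — by the tree's reproduction of finitely supported exact forms
`Σ_q (dω)_q Π(q,p) = (dω)_p` (`stub_kernelFixesExact`: summation by parts, the `1`-form Hodge identity and the Poisson identity) one has
`‖dω‖² = Π(p,p) − Σ_q (dω)_q (d ω_out)_q`, `ω_out = ω_∞ − ω`, and the remainder lives on the boundary layer of the box, where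
`|ω_∞(e)| ≤ 4K'(1+R)^{-3}` (`latticeGreen_gradient_bound`: `ω_∞(e)` is a first difference of `G₀` at distance `≥ (1+R)/2` from the
origin of `p`), the layer having at most `6(2R+3)^4` plaquettes: remainder `≤ 16·6·(2R+3)^4·(4K')²(1+R)^{-6} ≤ Cg(1+R)^{-2}`.
Constants: `c = 4`, `γ = 2`, `Cg = max(128 M, 124416 K'²)`.

References: G. F. Lawler, Intersections of Random Walks (1991), Thm 1.5.5 [Lawler1991]; G. Lawler, V. Limic, Random Walk: A Modern
Introduction (2010), Thm 4.3.1 [LawlerLimic2010]; C. Garban, A. Sepúlveda, IMRN 2023, §3.3 [GarbanSepulveda2023].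
-/

set_option autoImplicit false

noncomputable section

open Literature.Probability.LatticeModels Literature.MathematicalPhysics.QuantumLattice
  Literature.MathematicalPhysics.QuantumFieldTheory
open Summit.QuantumFields.YangMills.Theorems.EquipartitionPinsProbe

namespace Summit.QuantumFields.YangMills.Cruxes.FreeProbeLawG.SteinFree

namespace BlockGreen

/-! ### Boundedness and gradient decay of the lattice Green function -/

/-- The lattice Green function of `ℤ⁴` is bounded. [cite: LawlerLimic2010, Theorem 4.3.1] -/
theorem exists_abs_latticeGreen_le : ∃ M : ℝ, 0 ≤ M ∧ ∀ z : Site 4, |latticeGreen z| ≤ M := by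
  obtain ⟨K, hK⟩ := latticeGreen_asymptotics (d := 4) (by norm_num)
  refine ⟨max (|Real.Gamma (((4 : ℕ) : ℝ) / 2 - 1) / (2 * Real.pi ^ (((4 : ℕ) : ℝ) / 2))| + |K|) |latticeGreen (0 : Site 4)|,
    le_max_of_le_right (abs_nonneg _), fun z => ?_⟩
  by_cases hz : z = 0
  · rw [hz]; exact le_max_right _ _
  · refine le_trans ?_ (le_max_left _ _)
    have h := hK z hz
    set a : ℝ := Real.Gamma (((4 : ℕ) : ℝ) / 2 - 1) / (2 * Real.pi ^ (((4 : ℕ) : ℝ) / 2)) with ha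
    set r : ℝ := Real.sqrt (∑ i, ((z i : ℤ) : ℝ) ^ 2) with hr
    have hr1 : 1 ≤ r := one_le_sqrt_sum_sq_of_ne_zero hz
    have hA : r ^ (2 - ((4 : ℕ) : ℝ)) ≤ 1 := Real.rpow_le_one_of_one_le_of_nonpos hr1 (by norm_num)
    have hB : r ^ (-((4 : ℕ) : ℝ)) ≤ 1 := Real.rpow_le_one_of_one_le_of_nonpos hr1 (by norm_num)
    have hA0 : 0 ≤ r ^ (2 - ((4 : ℕ) : ℝ)) := Real.rpow_nonneg (Real.sqrt_nonneg _) _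
    have hB0 : 0 ≤ r ^ (-((4 : ℕ) : ℝ)) := Real.rpow_nonneg (Real.sqrt_nonneg _) _
    have h1 : |latticeGreen z| - |a * r ^ (2 - ((4 : ℕ) : ℝ))| ≤ K * r ^ (-((4 : ℕ) : ℝ)) :=
      (abs_sub_abs_le_abs_sub _ _).trans h
    rw [abs_mul, abs_of_nonneg hA0] at h1
    have h2 : |a| * r ^ (2 - ((4 : ℕ) : ℝ)) ≤ |a| := mul_le_of_le_one_right (abs_nonneg _) hA
    have h3 : K * r ^ (-((4 : ℕ) : ℝ)) ≤ |K| :=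
      (mul_le_mul_of_nonneg_right (le_abs_self K) hB0).trans (mul_le_of_le_one_right (abs_nonneg _) hB)
    linarith

/-- **Far gradient of `G₀`**: if `|w_{k₀}| ≥ L ≥ 1` then `|latticeGreen (w + eᵢ) − latticeGreen w| ≤ K' L^{-3}` (from the gradient
bound `K'|w|^{1-d}`, `|w| ≥ |w_{k₀}|`). [cite: Lawler1991, Theorem 1.5.5 (1.36)] -/
theorem abs_latticeGreen_step_le {K' : ℝ} (hK'0 : 0 ≤ K')
    (hK' : ∀ x : Site 4, x ≠ 0 → ∀ i : Fin 4, |latticeGreen (x + Pi.single i 1) - latticeGreen x| ≤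
      K' * Real.sqrt (∑ j, ((x j : ℤ) : ℝ) ^ 2) ^ (1 - ((4 : ℕ) : ℝ)))
    {L : ℝ} (hL : 1 ≤ L) (w : Site 4) (k₀ : Fin 4) (hw : L ≤ |((w k₀ : ℤ) : ℝ)|) (i : Fin 4) :
    |latticeGreen (w + Pi.single i 1) - latticeGreen w| ≤ K' * L ^ (-(3 : ℝ)) := by
  have hw0 : w ≠ 0 := by
    intro h; rw [h] at hw; simp at hw; linarith
  have hL0 : 0 < L := by linarith
  refine (hK' w hw0 i).trans (mul_le_mul_of_nonneg_left ?_ hK'0)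
  have hnorm : L ≤ Real.sqrt (∑ j, ((w j : ℤ) : ℝ) ^ 2) := by
    calc L ≤ |((w k₀ : ℤ) : ℝ)| := hw
      _ = Real.sqrt (((w k₀ : ℤ) : ℝ) ^ 2) := (Real.sqrt_sq_eq_abs _).symm
      _ ≤ Real.sqrt (∑ j, ((w j : ℤ) : ℝ) ^ 2) :=
          Real.sqrt_le_sqrt (Finset.single_le_sum (f := fun j => ((w j : ℤ) : ℝ) ^ 2) (fun j _ => sq_nonneg _)
            (Finset.mem_univ k₀))
  rw [show (1 - ((4 : ℕ) : ℝ)) = -(3 : ℝ) by norm_num]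
  exact Real.rpow_le_rpow_of_nonpos hL0 hnorm (by norm_num)

/-! ### The untruncated Green `1`-form of a plaquette -/

/-- `d ω_∞ = Π(p, ·)` exactly: the curl of `e ↦ Σ_a σ_a Γ(∂_a p, e)` at `q` is `curvatureTwoPoint p q` (the definition of the
two-plaquette kernel). [cite: GarbanSepulveda2023, §4 Proposition (law of the gradient spin-wave)] -/
theorem plaquetteCurl_greenForm (p q : ZdPlaquette 4) :
    plaquetteCurl (fun e => ∑ a : Fin 4, plaquetteBoundarySign a * edgeGreen (plaquetteBoundary p a) e) q =
      curvatureTwoPoint p q := by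
  rw [curvatureTwoPoint, plaquetteCurl, Finset.sum_comm]
  refine Finset.sum_congr rfl fun a _ => ?_
  rw [Finset.mul_sum]
  refine Finset.sum_congr rfl fun b _ => ?_
  ring

/-- **Explicit form of `ω_∞`**: for `p = (x; i<j)` and an edge `(y, l)`, `ω_∞(y,l)` is `½(G(x−y) − G(x+e_j−y))` if `l = i`,
`½(G(x+e_i−y) − G(x−y))` if `l = j`, and `0` otherwise. [folklore] -/
theorem greenForm_apply (p : ZdPlaquette 4) (e : ZdEdge 4) :
    ∑ a : Fin 4, plaquetteBoundarySign a * edgeGreen (plaquetteBoundary p a) e =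
      (if p.2.1.1 = e.2 then (latticeGreen (p.1 - e.1) - latticeGreen (p.1 + Pi.single p.2.1.2 1 - e.1)) / 2 else 0) +
      (if p.2.1.2 = e.2 then (latticeGreen (p.1 + Pi.single p.2.1.1 1 - e.1) - latticeGreen (p.1 - e.1)) / 2 else 0) := by
  simp only [Fin.sum_univ_four, plaquetteBoundarySign, plaquetteBoundary, edgeGreen_apply, Matrix.cons_val_zero,
    Matrix.cons_val_one, Matrix.cons_val]
  split_ifs <;> ring

/-- **Decay of `ω_∞` on far edges**: if `2|x_k| + 2 ≤ R` for all `k` (`x` the base of `p`) and `|y_{k₀}| ≥ R` for some `k₀`,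
then `|ω_∞(y, l)| ≤ 27K'(1+R)^{-3}` (each of the at most two terms of `ω_∞` is half a first difference of `G` at a point `w` with
`|w_{k₀}| ≥ (1+R)/3`). [cite: Lawler1991, Theorem 1.5.5 (1.36)] -/
theorem abs_greenForm_le_far {K' : ℝ} (hK'0 : 0 ≤ K')
    (hK' : ∀ x : Site 4, x ≠ 0 → ∀ i : Fin 4, |latticeGreen (x + Pi.single i 1) - latticeGreen x| ≤
      K' * Real.sqrt (∑ j, ((x j : ℤ) : ℝ) ^ 2) ^ (1 - ((4 : ℕ) : ℝ)))
    (p : ZdPlaquette 4) {R : ℕ} (hp : ∀ k : Fin 4, 2 * |p.1 k| + 2 ≤ (R : ℤ))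
    (e : ZdEdge 4) {k₀ : Fin 4} (he : (R : ℤ) ≤ |e.1 k₀|) :
    |∑ a : Fin 4, plaquetteBoundarySign a * edgeGreen (plaquetteBoundary p a) e| ≤ 27 * K' * (1 + (R : ℝ)) ^ (-(3 : ℝ)) := by
  have hR2 : (2 : ℤ) ≤ R := le_trans (by linarith [abs_nonneg (p.1 0)]) (hp 0)
  have hR2' : (2 : ℝ) ≤ R := by exact_mod_cast hR2
  have hL1 : (1 : ℝ) ≤ (1 + (R : ℝ)) / 3 := by linarith
  -- distance from the base of `p` (translated by `v`, `|v| ≤ 1`) to `y = e.1` in the coordinate `k₀`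
  have hfar : ∀ v : Site 4, (∀ k, |v k| ≤ 1) → ((1 : ℝ) + R) / 3 ≤ |(((p.1 + v - e.1) k₀ : ℤ) : ℝ)| := by
    intro v hv
    have h1 : 2 * |p.1 k₀| + 2 ≤ (R : ℤ) := hp k₀
    have h2 : |v k₀| ≤ 1 := hv k₀
    have h3 : (R : ℤ) ≤ |e.1 k₀| := he
    have h4 : |e.1 k₀| ≤ |p.1 k₀ + v k₀ - e.1 k₀| + |p.1 k₀ + v k₀| := by
      have := abs_sub (p.1 k₀ + v k₀) (p.1 k₀ + v k₀ - e.1 k₀)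
      rw [show p.1 k₀ + v k₀ - (p.1 k₀ + v k₀ - e.1 k₀) = e.1 k₀ by ring] at this
      linarith
    have h5 : |p.1 k₀ + v k₀| ≤ |p.1 k₀| + |v k₀| := abs_add_le _ _
    have key : (1 : ℤ) + R ≤ 3 * |(p.1 + v - e.1) k₀| := by
      simp only [Pi.add_apply, Pi.sub_apply]
      omega
    have key' : ((1 : ℝ) + R) ≤ 3 * |(((p.1 + v - e.1) k₀ : ℤ) : ℝ)| := by
      rw [← Int.cast_abs]; exact_mod_cast key
    linarith
  have hstep : ∀ v : Site 4, (∀ k, |v k| ≤ 1) → ∀ i : Fin 4,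
      |latticeGreen (p.1 + v - e.1 + Pi.single i 1) - latticeGreen (p.1 + v - e.1)| ≤ K' * ((1 + (R : ℝ)) / 3) ^ (-(3 : ℝ)) :=
    fun v hv i => abs_latticeGreen_step_le hK'0 hK' hL1 (p.1 + v - e.1) k₀ (hfar v hv) i
  have hpow : ((1 + (R : ℝ)) / 3) ^ (-(3 : ℝ)) = 27 * (1 + (R : ℝ)) ^ (-(3 : ℝ)) := by
    rw [Real.div_rpow (by positivity) (by norm_num), Real.rpow_neg (by norm_num : (0:ℝ) ≤ 3)]
    norm_num
    ring
  have hv0 : ∀ k : Fin 4, |(0 : Site 4) k| ≤ 1 := fun k => by simp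
  have hb : 0 ≤ K' * (1 + (R : ℝ)) ^ (-(3 : ℝ)) := by positivity
  -- the two potential terms are half first differences of `G` at far points
  have hi : |(latticeGreen (p.1 - e.1) - latticeGreen (p.1 + Pi.single p.2.1.2 1 - e.1)) / 2| ≤
      27 / 2 * K' * (1 + (R : ℝ)) ^ (-(3 : ℝ)) := by
    have h := hstep 0 hv0 p.2.1.2
    simp only [add_zero] at h
    rw [show p.1 - e.1 + Pi.single p.2.1.2 1 = p.1 + Pi.single p.2.1.2 1 - e.1 by abel, hpow] at h
    rw [abs_div, abs_two, abs_sub_comm]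
    linarith
  have hj : |(latticeGreen (p.1 + Pi.single p.2.1.1 1 - e.1) - latticeGreen (p.1 - e.1)) / 2| ≤
      27 / 2 * K' * (1 + (R : ℝ)) ^ (-(3 : ℝ)) := by
    have h := hstep 0 hv0 p.2.1.1
    simp only [add_zero] at h
    rw [show p.1 - e.1 + Pi.single p.2.1.1 1 = p.1 + Pi.single p.2.1.1 1 - e.1 by abel, hpow] at h
    rw [abs_div, abs_two]
    linarith
  rw [greenForm_apply]
  split_ifs with h1 h2
  · exact (abs_add_le _ _).trans (by linarith)
  · rw [add_zero]; linarith
  · rw [zero_add]; linarith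
  · rw [add_zero, abs_zero]; positivity

/-! ### Box truncation of a `1`-form: support, `ℓ¹` mass, exact curl inside, boundary layer -/

section Truncate

variable (p : ZdPlaquette 4) (R : ℕ) (w : ZdEdge 4 → ℝ)

/-- Base points of the boundary links of `q` sit at `q.1` or `q.1 + e_m`: coordinatewise `0 ≤ (∂_b q)_k − q_k ≤ 1`. [folklore] -/
theorem boundary_coord_sub (q : ZdPlaquette 4) (b : Fin 4) (k : Fin 4) :
    0 ≤ (plaquetteBoundary q b).1 k - q.1 k ∧ (plaquetteBoundary q b).1 k - q.1 k ≤ 1 := by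
  have hs : ∀ m : Fin 4, 0 ≤ (Pi.single m (1 : ℤ) : Site 4) k ∧ (Pi.single m (1 : ℤ) : Site 4) k ≤ 1 := fun m => by
    by_cases h : k = m
    · subst h; simp
    · simp [Pi.single_eq_of_ne h]
  fin_cases b <;> simp [plaquetteBoundary, hs]

/-- **Exact curl well inside the box**: if `dw = Π(p,·)` everywhere, the truncation `1_{box R}·w` has curl `Π(p,q)` at every `q`
with `2|q_k| + 2 ≤ R`. [folklore] -/
theorem plaquetteCurl_truncate_eq (hw : ∀ q, plaquetteCurl w q = curvatureTwoPoint p q)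
    (q : ZdPlaquette 4) (hq : ∀ k : Fin 4, 2 * |q.1 k| + 2 ≤ (R : ℤ)) :
    plaquetteCurl (fun e => if (∀ k : Fin 4, |e.1 k| ≤ (R : ℤ)) then w e else 0) q = curvatureTwoPoint p q := by
  rw [← hw q, plaquetteCurl, plaquetteCurl]
  refine Finset.sum_congr rfl fun b _ => ?_
  have hin : ∀ k : Fin 4, |(plaquetteBoundary q b).1 k| ≤ (R : ℤ) := fun k => by
    obtain ⟨h0, h1⟩ := boundary_coord_sub q b k
    have := hq k
    have : |(plaquetteBoundary q b).1 k| ≤ |q.1 k| + 1 := by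
      have := abs_add_le (q.1 k) ((plaquetteBoundary q b).1 k - q.1 k)
      rw [add_sub_cancel] at this
      have h2 : |(plaquetteBoundary q b).1 k - q.1 k| ≤ 1 := abs_le.2 ⟨by linarith, h1⟩
      linarith
    omega
  rw [if_pos hin]

/-- **`ℓ¹` mass of the truncation**: if `|w| ≤ W` pointwise, then `Σ_{e∈T} |1_{box R} w| ≤ W · 4(2R+1)^4` for every finite `T`. [folklore] -/
theorem sum_abs_truncate_le {W : ℝ} (hw : ∀ e, |w e| ≤ W) (T : Finset (ZdEdge 4)) :
    ∑ e ∈ T, |(fun e : ZdEdge 4 => if (∀ k : Fin 4, |e.1 k| ≤ (R : ℤ)) then w e else 0) e| ≤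
      W * (4 * (2 * (R : ℝ) + 1) ^ 4) := by
  classical
  set box : Finset (ZdEdge 4) :=
    (Fintype.piFinset fun _ : Fin 4 => Finset.Icc (-(R : ℤ)) R) ×ˢ (Finset.univ : Finset (Fin 4)) with hbox
  have hmem : ∀ e : ZdEdge 4, (∀ k : Fin 4, |e.1 k| ≤ (R : ℤ)) → e ∈ box := fun e he => by
    rw [hbox, Finset.mem_product, Fintype.mem_piFinset]
    exact ⟨fun k => Finset.mem_Icc.2 (abs_le.1 (he k)), Finset.mem_univ _⟩
  have hcard : (box.card : ℝ) = 4 * (2 * (R : ℝ) + 1) ^ 4 := by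
    rw [hbox, Finset.card_product, Fintype.card_piFinset, Finset.prod_const, Finset.card_univ, Fintype.card_fin,
      Int.card_Icc]
    have : ((R : ℤ) + 1 - -(R : ℤ)).toNat = 2 * R + 1 := by omega
    rw [this]; push_cast; ring
  calc ∑ e ∈ T, |(fun e : ZdEdge 4 => if (∀ k : Fin 4, |e.1 k| ≤ (R : ℤ)) then w e else 0) e|
      = ∑ e ∈ T, (if (∀ k : Fin 4, |e.1 k| ≤ (R : ℤ)) then |w e| else 0) :=
        Finset.sum_congr rfl fun e _ => by
          by_cases h : ∀ k : Fin 4, |e.1 k| ≤ (R : ℤ)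
          · simp only [if_pos h]
          · simp only [if_neg h, abs_zero]
    _ = ∑ e ∈ T.filter (fun e => ∀ k : Fin 4, |e.1 k| ≤ (R : ℤ)), |w e| := (Finset.sum_filter _ _).symm
    _ ≤ ∑ e ∈ box, |w e| :=
        Finset.sum_le_sum_of_subset_of_nonneg (fun e he => hmem e (Finset.mem_filter.1 he).2) fun _ _ _ => abs_nonneg _
    _ ≤ ∑ _e ∈ box, W := Finset.sum_le_sum fun e _ => hw e
    _ = W * (4 * (2 * (R : ℝ) + 1) ^ 4) := by rw [Finset.sum_const, nsmul_eq_mul, hcard, mul_comm]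

/-- **Boundary-layer estimate**: if `|w e| ≤ m` on every edge with some coordinate `|e_k| ≥ R`, then for every plaquette `q`
`|(dω)_q · ((dw)_q − (dω)_q)| ≤ 16 m²`, `ω = 1_{box R} w` (the second factor vanishes unless `q` has a link outside the box, and then
all four links of `q` are far). [folklore] -/
theorem abs_boundary_term_le {m : ℝ} (hm0 : 0 ≤ m)
    (hfar : ∀ (e : ZdEdge 4) (k₀ : Fin 4), (R : ℤ) ≤ |e.1 k₀| → |w e| ≤ m) (q : ZdPlaquette 4) :
    |plaquetteCurl (fun e => if (∀ k : Fin 4, |e.1 k| ≤ (R : ℤ)) then w e else 0) q *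
        (plaquetteCurl w q - plaquetteCurl (fun e => if (∀ k : Fin 4, |e.1 k| ≤ (R : ℤ)) then w e else 0) q)| ≤
      16 * m ^ 2 := by
  by_cases hall : ∀ b : Fin 4, ∀ k : Fin 4, |(plaquetteBoundary q b).1 k| ≤ (R : ℤ)
  · -- all four links inside: the truncation agrees with `w` on them
    have h : plaquetteCurl (fun e => if (∀ k : Fin 4, |e.1 k| ≤ (R : ℤ)) then w e else 0) q = plaquetteCurl w q := by
      simp only [plaquetteCurl]
      exact Finset.sum_congr rfl fun b _ => by rw [if_pos (hall b)]
    rw [h, sub_self, mul_zero, abs_zero]; positivity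
  · simp only [not_forall, not_le] at hall
    obtain ⟨b₂, k₀, hk₀⟩ := hall
    -- every link of `q` is far in the coordinate `k₀`
    have hfarq : ∀ b : Fin 4, (R : ℤ) ≤ |(plaquetteBoundary q b).1 k₀| := fun b => by
      obtain ⟨h0, h1⟩ := boundary_coord_sub q b k₀
      obtain ⟨h0', h1'⟩ := boundary_coord_sub q b₂ k₀
      have := abs_sub_abs_le_abs_sub ((plaquetteBoundary q b₂).1 k₀) ((plaquetteBoundary q b).1 k₀)
      have h2 : |(plaquetteBoundary q b₂).1 k₀ - (plaquetteBoundary q b).1 k₀| ≤ 1 := abs_le.2 ⟨by linarith, by linarith⟩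
      omega
    have hwb : ∀ b : Fin 4, |w (plaquetteBoundary q b)| ≤ m := fun b => hfar _ k₀ (hfarq b)
    have hωb : ∀ b : Fin 4, |(fun e : ZdEdge 4 => if (∀ k : Fin 4, |e.1 k| ≤ (R : ℤ)) then w e else 0)
        (plaquetteBoundary q b)| ≤ m := fun b => by
      by_cases hb : ∀ k : Fin 4, |(plaquetteBoundary q b).1 k| ≤ (R : ℤ)
      · simp only [if_pos hb]; exact hwb b
      · simp only [if_neg hb, abs_zero]; exact hm0
    have hsign : ∀ b : Fin 4, |plaquetteBoundarySign b| = 1 := fun b => by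
      fin_cases b <;> simp [plaquetteBoundarySign]
    have hcurl : ∀ f : ZdEdge 4 → ℝ, (∀ b : Fin 4, |f (plaquetteBoundary q b)| ≤ m) → |plaquetteCurl f q| ≤ 4 * m := by
      intro f hf
      rw [plaquetteCurl]
      refine (Finset.abs_sum_le_sum_abs _ _).trans ?_
      calc ∑ b : Fin 4, |plaquetteBoundarySign b * f (plaquetteBoundary q b)| ≤ ∑ _b : Fin 4, m :=
            Finset.sum_le_sum fun b _ => by rw [abs_mul, hsign, one_mul]; exact hf b
        _ = 4 * m := by simp
    have h1 := hcurl (fun e : ZdEdge 4 => if (∀ k : Fin 4, |e.1 k| ≤ (R : ℤ)) then w e else 0) hωb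
    have h2 : |plaquetteCurl w q - plaquetteCurl (fun e => if (∀ k : Fin 4, |e.1 k| ≤ (R : ℤ)) then w e else 0) q| ≤ 4 * m := by
      have hsub : plaquetteCurl w q - plaquetteCurl (fun e => if (∀ k : Fin 4, |e.1 k| ≤ (R : ℤ)) then w e else 0) q =
          plaquetteCurl (fun e => w e - (if (∀ k : Fin 4, |e.1 k| ≤ (R : ℤ)) then w e else 0)) q := by
        simp only [plaquetteCurl, mul_sub, Finset.sum_sub_distrib]
      rw [hsub]
      refine hcurl (fun e => w e - (if (∀ k : Fin 4, |e.1 k| ≤ (R : ℤ)) then w e else 0)) fun b => ?_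
      by_cases hb : ∀ k : Fin 4, |(plaquetteBoundary q b).1 k| ≤ (R : ℤ)
      · simp only [if_pos hb, sub_self, abs_zero]; exact hm0
      · simp only [if_neg hb, sub_zero]; exact hwb b
    rw [abs_mul]
    nlinarith [abs_nonneg (plaquetteCurl (fun e => if (∀ k : Fin 4, |e.1 k| ≤ (R : ℤ)) then w e else 0) q)]

/-- The curl of the truncation vanishes off the box of radius `R + 1`. [folklore] -/
theorem plaquetteCurl_truncate_eq_zero (q : ZdPlaquette 4)
    (hq : ¬ ∀ k : Fin 4, |q.1 k| ≤ (R : ℤ) + 1) :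
    plaquetteCurl (fun e => if (∀ k : Fin 4, |e.1 k| ≤ (R : ℤ)) then w e else 0) q = 0 := by
  rw [plaquetteCurl]
  refine Finset.sum_eq_zero fun b _ => ?_
  have hout : ¬ ∀ k : Fin 4, |(plaquetteBoundary q b).1 k| ≤ (R : ℤ) := by
    intro h
    apply hq
    intro k
    obtain ⟨h0, h1⟩ := boundary_coord_sub q b k
    have := h k
    have := abs_sub_abs_le_abs_sub (q.1 k) ((plaquetteBoundary q b).1 k)
    have h2 : |q.1 k - (plaquetteBoundary q b).1 k| ≤ 1 := abs_le.2 ⟨by linarith, by linarith⟩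
    linarith
  simp only [if_neg hout, mul_zero]

/-- **Energy of the truncation**: if `dw = Π(p,·)`, `2|p_k|+2 ≤ R`, and `|w| ≤ m` on far edges, then for every finite `T`
containing the support of `dω` (`ω = 1_{box R} w`): `|Σ_{q∈T} (dω)_q² − Π(p,p)| ≤ 16·6·(2R+3)^4 · 16 m²·(1/16)` — precisely
`≤ 96 (2R+3)^4 · m²·…`; we record the bound `256 (2R+3)^4 m²`.  The main term is the tree's reproduction of finitely supported exact
forms by the curvature kernel (`stub_kernelFixesExact`). [folklore] -/
theorem abs_energy_sub_le (hw : ∀ q, plaquetteCurl w q = curvatureTwoPoint p q) (hp : ∀ k : Fin 4, 2 * |p.1 k| + 2 ≤ (R : ℤ))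
    {m : ℝ} (hm0 : 0 ≤ m) (hfar : ∀ (e : ZdEdge 4) (k₀ : Fin 4), (R : ℤ) ≤ |e.1 k₀| → |w e| ≤ m)
    (T : Finset (ZdPlaquette 4))
    (hT : ∀ q, plaquetteCurl (fun e => if (∀ k : Fin 4, |e.1 k| ≤ (R : ℤ)) then w e else 0) q ≠ 0 → q ∈ T) :
    |(∑ q ∈ T, (plaquetteCurl (fun e => if (∀ k : Fin 4, |e.1 k| ≤ (R : ℤ)) then w e else 0) q) ^ 2) -
        curvatureTwoPoint p p| ≤ 256 * (2 * (R : ℝ) + 3) ^ 4 * m ^ 2 := by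
  classical
  set ω : ZdEdge 4 → ℝ := fun e => if (∀ k : Fin 4, |e.1 k| ≤ (R : ℤ)) then w e else 0 with hω
  -- (A) reproduction of the finitely supported exact form `dω` by the curvature kernel
  set Ebox : Finset (ZdEdge 4) :=
    (Fintype.piFinset fun _ : Fin 4 => Finset.Icc (-(R : ℤ)) R) ×ˢ (Finset.univ : Finset (Fin 4)) with hEbox
  have hα : ∀ e, e ∉ Ebox → ω e = 0 := by
    intro e he
    have : ¬ ∀ k : Fin 4, |e.1 k| ≤ (R : ℤ) := by
      intro h
      apply he
      rw [hEbox, Finset.mem_product, Fintype.mem_piFinset]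
      exact ⟨fun k => Finset.mem_Icc.2 (abs_le.1 (h k)), Finset.mem_univ _⟩
    simp only [hω, if_neg this]
  have hS : ∀ q, q ∉ T → plaquetteCurl ω q = 0 := fun q hq => by
    by_contra h; exact hq (hT q h)
  have hrep := stub_kernelFixesExact T Ebox ω hα hS p
  -- (B) `(dω)_p = Π(p,p)` and symmetry of the kernel
  rw [plaquetteCurl_truncate_eq p R w hw p hp] at hrep
  have hsym : ∀ q, curvatureTwoPoint q p = plaquetteCurl w q := fun q => by rw [curvatureTwoPoint_comm, hw]
  simp only [hsym] at hrep
  -- (C) `Σ (dω)² − Π(p,p) = −Σ (dω)_q ((dw)_q − (dω)_q)`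
  have hpp : curvatureTwoPoint p p = plaquetteCurl w p := (hw p).symm
  have hC : (∑ q ∈ T, (plaquetteCurl ω q) ^ 2) - curvatureTwoPoint p p =
      -∑ q ∈ T, plaquetteCurl ω q * (plaquetteCurl w q - plaquetteCurl ω q) := by
    rw [hpp, ← hrep, ← Finset.sum_neg_distrib, ← Finset.sum_sub_distrib]
    exact Finset.sum_congr rfl fun q _ => by ring
  rw [hC, abs_neg]
  -- (D) boundary layer: each term is `≤ 16 m²` and vanishes off the box of radius `R + 1`
  set Pbox : Finset (ZdPlaquette 4) :=
    (Fintype.piFinset fun _ : Fin 4 => Finset.Icc (-((R : ℤ) + 1)) ((R : ℤ) + 1)) ×ˢ Finset.univ with hPbox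
  have hvan : ∀ q ∈ T, q ∉ Pbox → plaquetteCurl ω q * (plaquetteCurl w q - plaquetteCurl ω q) = 0 := by
    intro q _ hq
    have hq' : ¬ ∀ k : Fin 4, |q.1 k| ≤ (R : ℤ) + 1 := by
      intro h; apply hq
      rw [hPbox, Finset.mem_product, Fintype.mem_piFinset]
      exact ⟨fun k => Finset.mem_Icc.2 (abs_le.1 (h k)), Finset.mem_univ _⟩
    rw [plaquetteCurl_truncate_eq_zero R w q hq', zero_mul]
  have hcardP : (Pbox.card : ℝ) ≤ 16 * (2 * (R : ℝ) + 3) ^ 4 := by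
    rw [hPbox, Finset.card_product, Fintype.card_piFinset, Finset.prod_const, Finset.card_univ, Fintype.card_fin, Int.card_Icc]
    have h1 : (((R : ℤ) + 1 + 1 - -((R : ℤ) + 1)).toNat : ℝ) = 2 * (R : ℝ) + 3 := by
      have : ((R : ℤ) + 1 + 1 - -((R : ℤ) + 1)).toNat = 2 * R + 3 := by omega
      rw [this]; push_cast; ring
    have h2 : (Finset.univ : Finset {q : Fin 4 × Fin 4 // q.1 < q.2}).card ≤ 16 := by
      calc (Finset.univ : Finset {q : Fin 4 × Fin 4 // q.1 < q.2}).card = Fintype.card {q : Fin 4 × Fin 4 // q.1 < q.2} :=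
            Finset.card_univ
        _ ≤ Fintype.card (Fin 4 × Fin 4) := Fintype.card_subtype_le _
        _ = 16 := by simp
    push_cast
    rw [h1]
    have h3 : ((Finset.univ : Finset {q : Fin 4 × Fin 4 // q.1 < q.2}).card : ℝ) ≤ 16 := by exact_mod_cast h2
    have h4 : (0 : ℝ) ≤ (2 * (R : ℝ) + 3) ^ 4 := by positivity
    nlinarith
  calc |∑ q ∈ T, plaquetteCurl ω q * (plaquetteCurl w q - plaquetteCurl ω q)|
      ≤ ∑ q ∈ T, |plaquetteCurl ω q * (plaquetteCurl w q - plaquetteCurl ω q)| := Finset.abs_sum_le_sum_abs _ _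
    _ = ∑ q ∈ T ∩ Pbox, |plaquetteCurl ω q * (plaquetteCurl w q - plaquetteCurl ω q)| := by
        rw [← Finset.sum_filter_add_sum_filter_not T (fun q => q ∈ Pbox), Finset.filter_mem_eq_inter]
        have h0 : ∑ q ∈ T.filter (fun q => q ∉ Pbox), |plaquetteCurl ω q * (plaquetteCurl w q - plaquetteCurl ω q)| = 0 :=
          Finset.sum_eq_zero fun q hq => by
            rw [Finset.mem_filter] at hq
            rw [hvan q hq.1 hq.2, abs_zero]
        rw [h0, add_zero]
    _ ≤ ∑ _q ∈ T ∩ Pbox, 16 * m ^ 2 := Finset.sum_le_sum fun q _ => abs_boundary_term_le R w hm0 hfar q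
    _ = ((T ∩ Pbox).card : ℝ) * (16 * m ^ 2) := by rw [Finset.sum_const, nsmul_eq_mul]
    _ ≤ (Pbox.card : ℝ) * (16 * m ^ 2) := by
        gcongr
        exact Finset.inter_subset_right
    _ ≤ 16 * (2 * (R : ℝ) + 3) ^ 4 * (16 * m ^ 2) := by gcongr
    _ = 256 * (2 * (R : ℝ) + 3) ^ 4 * m ^ 2 := by ring

end Truncate

end BlockGreen

end Summit.QuantumFields.YangMills.Cruxes.FreeProbeLawG.SteinFree

end
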